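import Literature.Topology.FourManifolds.SmoothHomologicalOrientationProofs
import Literature.AlgebraicTopology.SingularHomology.SphereLikeToLocal
import Literature.AlgebraicTopology.SingularHomology.UniverseTransportOrientation
import Literature.AlgebraicTopology.SingularHomology.TripleSequence
import Mathlib.Geometry.Manifold.Instances.Sphere
import HarnessLib

/-!
# A generator of `Hₖ(Sᵏ; ℤ)` restricts to the local classes of a compatible orientation, up to a
# global sign; its local pieces in a Euclidean model, in any universe

Topic `Literature/Topology/FourManifolds`; a brick for the fact seat
`provefact-Literature.Topology.FourManifolds.Cobordism.Milnor1965_intersectionNumber_slab` (Milnor,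
*Lectures on the h-cobordism theorem* (1965), Lemma 7.2 / Lemma 6.3 in the tree's homological form,
`Literature.Topology.FourManifolds.Cobordism.Milnor1965_intersectionNumber_slab_of_sphereClass`,
`HCobordismIntersectionNumberSlab.lean`).  In Lemma 7.2 the class `[M] ∈ H_λ(M)` is *"the
orientation generator"* of the oriented closed manifold `M` (PDF p. 46), and the proof of Lemma 6.3
(PDF p. 37) uses that it restricts to *"the orientation generator `γᵢ`"* of `H_r(Uᵢ, Uᵢ - pᵢ)` at
every crossing point — the generator singled out by the (smooth) orientation of `M`, whose
comparison with a positively oriented frame is the sign of Def. 6.1.  In the tree `M = Sᵏ` carries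
a smooth orientation `oS` (`Literature.Topology.FourManifolds.SmoothOrientation`), the class is an
arbitrary generator `σ` of `Hₖ ≅ ℤ` of the embedded copy `T ≅ Sᵏ` (a space of the universe of the
cobordism), and the local degree computations of `…TransverseDiscFunctional` read local classes in
Euclidean models `e : B(φ y, δ) ≃ U ⊆ T` through the preferred charts `φ = chartAt y`.  This file
supplies the dictionary:

* `sphereGeneratorOrientation` — the restrictions of a generator `σ'` of `Hₖ(Sᵏ)` (`k ≥ 1`) to the
  points form a homological orientation (`…SphereLikeToLocal`); hence
  `exists_units_forall_toLocal_eq_smul` — for any homological orientation `μ` of `Sᵏ` there is a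
  global sign `t = ±1` with `σ'|_y = t • μ_y` for all `y` (two orientations of a connected manifold,
  `HomologicalOrientation.eq_or_eq_neg_of_connected_holds`);
* `SmoothOrientation.localClass_eq_signAt_smul_map_ball` — for a smooth orientation `o` of a
  manifold `M` (universe `0`) and `μ` compatible with `o` at `y` (`IsCompatibleAt g o μ y`, Bredon
  VI.7), `μ_y = ε_y • (φ⁻¹|_B)⁎ g_{φ y}` for every ball `B = B(φ y, δ)` inside the chart target,
  `ε_y = signAt o y = ±1` the orientation character of the preferred chart (`+1` iff `o y` is the
  standard orientation; `orientationSign (o y)` of `IntersectionNumbers.lean`);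
* **`exists_units_forall_map_subsetIncl_smul_xEquiv_eq_toLocal`** — the form consumed by
  `TransverseDiscDatum.functional_ofAbsolute_map_eq_sum`: for `ψ : Sᵏ ≃ₜ T` (any universe), a
  smooth orientation `oS` of `Sᵏ` and a generator `σ` of `Hₖ(T; ℤ)`, there is `t = ±1` such that
  for every `y`, every ball `B(φ y, δ)` in the chart target and every Euclidean model
  `e : B ≃ U ⊆ T` with `e v = ψ (φ⁻¹ v)`, the class `(t ε_y) • e⁎ g_{φ y}` pushed into `Hₖ(T | e(φ y))`
  is the restriction `σ|_{e(φ y)}` (transport across universes, `relativeSingularHomology.xEquiv_map`,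
  `localHomology.xEquiv_toLocal`).

Everything here is proved; the only definition is the orientation built from a generator.

## References

* J. Milnor, *Lectures on the h-cobordism theorem*, notes by L. Siebenmann and J. Sondow,
  Princeton Mathematical Notes (1965), Lemma 6.3 and its proof (PDF p. 37), Lemma 7.2 (PDF p. 46).
  Held: `lit read book:milnornd-lectures-h-cobordism-theorem`. [MilnorHCobordism1965]
* G. E. Bredon, *Topology and Geometry*, GTM 139 (1993), VI.7 Prop. 7.14, Thm. 7.15. [Bredon1993]
* A. Hatcher, *Algebraic Topology*, CUP 2002, §3.3 pp. 233–236, Thm. 3.26. [HatcherAT2002]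
-/

open scoped Manifold ContDiff Topology
open Set Function CategoryTheory Module Metric
open Literature.AlgebraicTopology.SingularHomology

noncomputable section

namespace Literature.Topology.FourManifolds

universe u

/-- Local notation: `𝔼 n` is the model Euclidean space `EuclideanSpace ℝ (Fin n)`. -/
local notation "𝔼 " n:arg => EuclideanSpace ℝ (Fin n)

/-- Local notation: `𝕊 n` is the unit sphere in `EuclideanSpace ℝ (Fin (n + 1))`, Mathlib's
smooth manifold modelled on `𝓡 n`. -/
local notation "𝕊 " n:arg => (Metric.sphere (0 : EuclideanSpace ℝ (Fin (n + 1))) 1)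

/-! ### The orientation of `Sᵏ` determined by a generator of `Hₖ(Sᵏ)` -/

section Sphere

variable {k : ℕ}

/-- **The homological orientation of `Sᵏ` determined by a generator of `Hₖ(Sᵏ; ℤ)`** (`k ≥ 1`):
its local classes are the restrictions of the generator, which generate
(`exists_linearEquiv_toLocal_eq_one_of_homeomorph_sphere`) and are restrictions of one global
class (Hatcher 2002, Thm. 3.26: a fundamental class restricts to a consistent choice of local
orientations). [cite: HatcherAT2002, §3.3 Thm. 3.26] -/
def sphereGeneratorOrientation (hk : k ≠ 0) (σ : singularHomology ℤ ℤ (𝕊 k) k)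
    (hσ : ∃ e : singularHomology ℤ ℤ (𝕊 k) k ≃ₗ[ℤ] ℤ, e σ = 1) : HomologicalOrientation ℤ (𝕊 k) k where
  localClass y := singularHomology.toLocal ℤ ℤ y k σ
  isGenerator y := exists_linearEquiv_toLocal_eq_one_of_homeomorph_sphere hk (Homeomorph.refl _) y hσ
  locallyConsistent _ := ⟨univ, Filter.univ_mem, singularHomology.toLocalOfSet ℤ ℤ (𝕊 k) univ k σ,
    fun _ hz => singularHomology.restrictToPoint_toLocalOfSet ℤ ℤ hz k σ⟩

/-- Unfolding the local classes of `sphereGeneratorOrientation`. [folklore] -/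
@[simp] theorem sphereGeneratorOrientation_localClass (hk : k ≠ 0) (σ : singularHomology ℤ ℤ (𝕊 k) k)
    (hσ : ∃ e : singularHomology ℤ ℤ (𝕊 k) k ≃ₗ[ℤ] ℤ, e σ = 1) (y : 𝕊 k) :
    (sphereGeneratorOrientation hk σ hσ).localClass y = singularHomology.toLocal ℤ ℤ y k σ := rfl

/-- **A generator of `Hₖ(Sᵏ; ℤ)` restricts to `±` the local classes of any homological orientation,
with a global sign** (`k ≥ 1`; Hatcher 2002, §3.3: a connected orientable manifold has exactly the
two orientations `±μ`, `HomologicalOrientation.eq_or_eq_neg_of_connected_holds`). This is Milnor's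
"orientation generator `[M]` restricting to the orientation generators `γᵢ`" (PDF p. 37) for an
orientation fixed in advance. [cite: HatcherAT2002, §3.3 p. 235 and Thm. 3.26; MilnorHCobordism1965, proof of Lemma 6.3 (PDF p. 37)] -/
theorem exists_units_forall_toLocal_eq_smul (hk : k ≠ 0) (μ : HomologicalOrientation ℤ (𝕊 k) k)
    (σ : singularHomology ℤ ℤ (𝕊 k) k) (hσ : ∃ e : singularHomology ℤ ℤ (𝕊 k) k ≃ₗ[ℤ] ℤ, e σ = 1) :
    ∃ t : ℤˣ, ∀ y : 𝕊 k, singularHomology.toLocal ℤ ℤ y k σ = (t : ℤ) • μ.localClass y := by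
  haveI : PathConnectedSpace (𝕊 k) := pathConnectedSpace_sphere hk
  rcases HomologicalOrientation.eq_or_eq_neg_of_connected_holds (𝕊 k)
    (sphereGeneratorOrientation hk σ hσ) μ with h | h
  · refine ⟨1, fun y => ?_⟩
    rw [← sphereGeneratorOrientation_localClass hk σ hσ y, h, Units.val_one, one_zsmul]
  · refine ⟨-1, fun y => ?_⟩
    rw [← sphereGeneratorOrientation_localClass hk σ hσ y, h, Units.val_neg, Units.val_one, neg_one_zsmul,
      HomologicalOrientation.neg_localClass]

end Sphere

/-! ### The local class of a compatible orientation in a Euclidean model -/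

namespace SmoothOrientation

section Model

variable {n : ℕ} {M : Type} [TopologicalSpace M] [ChartedSpace (𝔼 n) M]

/-- The inverse chart on a ball `B ⊆ φ.target` as a continuous map `B → M`. [folklore] -/
def ballInv (y : M) {δ : ℝ} (hB : ball (chartAt (𝔼 n) y y) δ ⊆ (chartAt (𝔼 n) y).target) :
    C(↥(ball (chartAt (𝔼 n) y y) δ), M) :=
  ⟨fun v => (chartAt (𝔼 n) y).symm v,
    (chartAt (𝔼 n) y).continuousOn_symm.comp_continuous continuous_subtype_val fun v => hB v.2⟩

/-- Unfolding `ballInv`. [folklore] -/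
@[simp] theorem ballInv_apply (y : M) {δ : ℝ} (hB : ball (chartAt (𝔼 n) y y) δ ⊆ (chartAt (𝔼 n) y).target)
    (v : ↥(ball (chartAt (𝔼 n) y y) δ)) : ballInv y hB v = (chartAt (𝔼 n) y).symm v := rfl

/-- `ballInv` sends the centre to `y` and the punctured ball into `M ∖ y` (the inverse chart is
injective on the target). [folklore] -/
theorem mapsTo_ballInv (y : M) {δ : ℝ} (hδ : 0 < δ) (hB : ball (chartAt (𝔼 n) y y) δ ⊆ (chartAt (𝔼 n) y).target) :
    MapsTo (ballInv y hB) ({(⟨chartAt (𝔼 n) y y, mem_ball_self hδ⟩ : ↥(ball (chartAt (𝔼 n) y y) δ))}ᶜ : Set _)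
      ({y}ᶜ : Set M) := by
  intro v hv h
  apply hv
  rw [mem_singleton_iff] at h ⊢
  apply Subtype.ext
  change (v : 𝔼 n) = chartAt (𝔼 n) y y
  have h1 : chartAt (𝔼 n) y ((chartAt (𝔼 n) y).symm v) = chartAt (𝔼 n) y y := by
    rw [ballInv_apply] at h
    rw [h]
  rwa [(chartAt (𝔼 n) y).right_inv (hB v.2)] at h1

variable [IsManifold (𝓡 n) 1 M]

/-- **The local class of a compatible orientation in a Euclidean model** (Bredon 1993, VI.7: the
local class attached to a positively oriented chart).  If `μ` is compatible with the smooth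
orientation `o` at `y` (generator convention `g`), then for every ball `B = B(φ y, δ)` inside the
target of the preferred chart `φ = chartAt y`,
`μ_y = ε_y • (φ⁻¹|_B)⁎ g_{φ y}`, where `ε_y = signAt o y` (`+1` iff `o y` is the standard
orientation) and `g_{φ y}` is excised to `B`. [cite: Bredon1993, VI.7 Prop. 7.14 and Thm. 7.15; HatcherAT2002, §3.3 p. 231] -/
theorem localClass_eq_signAt_smul_map_ball (g : HomologicalOrientation ℤ (𝔼 n) n)
    {o : SmoothOrientation (𝓡 n) M} {μ : HomologicalOrientation ℤ M n} {y : M}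
    (h : IsCompatibleAt g o μ y) {δ : ℝ} (hδ : 0 < δ)
    (hB : ball (chartAt (𝔼 n) y y) δ ⊆ (chartAt (𝔼 n) y).target) :
    μ.localClass y = (signAt o y : ℤ) •
      relativeSingularHomology.map ℤ ℤ (ballInv y hB) (mapsTo_ballInv y hδ hB) n
        ((localHomology.openSubsetIso ℤ ℤ isOpen_ball (mem_ball_self hδ) n).inv
          (g.localClass (chartAt (𝔼 n) y y))) := by
  haveI := isIso_pushChart (n := n) y n
  -- the model map into the chart source
  set B := ball (chartAt (𝔼 n) y y) δ with hBdef
  have hsrc : ∀ v : ↥B, (chartAt (𝔼 n) y).symm v ∈ (chartAt (𝔼 n) y).source := fun v =>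
    (chartAt (𝔼 n) y).map_target (hB v.2)
  let f₀ : C(↥B, ↥(chartAt (𝔼 n) y).source) :=
    ⟨fun v => ⟨(chartAt (𝔼 n) y).symm v, hsrc v⟩, (ballInv y hB).continuous.subtype_mk _⟩
  have hf₀ : MapsTo f₀ ({(⟨chartAt (𝔼 n) y y, mem_ball_self hδ⟩ : ↥B)}ᶜ : Set ↥B)
      ({chartSourcePt y}ᶜ : Set ↥(chartAt (𝔼 n) y).source) := by
    intro v hv h'
    exact mapsTo_ballInv y hδ hB hv (congrArg (fun w : ↥(chartAt (𝔼 n) y).source => (w : M)) h')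
  -- `ballInv = incl ∘ f₀`, `chartRestrict ∘ f₀ = subsetIncl B`
  have e1 : relativeSingularHomology.map ℤ ℤ (ballInv y hB) (mapsTo_ballInv y hδ hB) n =
      relativeSingularHomology.map ℤ ℤ f₀ hf₀ n ≫ pushIncl y n := by
    rw [pushIncl, localHomology.push_def, ← relativeSingularHomology.map_comp]
    rfl
  have e2 : relativeSingularHomology.map ℤ ℤ f₀ hf₀ n ≫ pushChart y n =
      relativeSingularHomology.map ℤ ℤ (subsetIncl B) (localHomology.mapsTo_subsetIncl_compl (mem_ball_self hδ)) n := by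
    rw [pushChart, localHomology.push_def, ← relativeSingularHomology.map_comp]
    exact relativeSingularHomology.map_congr ℤ ℤ
      (ContinuousMap.ext fun v => (chartAt (𝔼 n) y).right_inv (hB v.2)) _ _ n
  -- hence `f₀⁎ (g|B) = (pushChart)⁻¹ g`
  have e3 : relativeSingularHomology.map ℤ ℤ f₀ hf₀ n
      ((localHomology.openSubsetIso ℤ ℤ isOpen_ball (mem_ball_self hδ) n).inv (g.localClass (chartAt (𝔼 n) y y))) =
      inv (pushChart y n) (g.localClass (chartAt (𝔼 n) y y)) := by
    have h1 : pushChart y n (relativeSingularHomology.map ℤ ℤ f₀ hf₀ n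
        ((localHomology.openSubsetIso ℤ ℤ isOpen_ball (mem_ball_self hδ) n).inv (g.localClass (chartAt (𝔼 n) y y)))) =
        g.localClass (chartAt (𝔼 n) y y) := by
      rw [← ModuleCat.comp_apply, e2]
      change ((localHomology.openSubsetIso ℤ ℤ isOpen_ball (mem_ball_self hδ) n).inv ≫
        (localHomology.openSubsetIso ℤ ℤ isOpen_ball (mem_ball_self hδ) n).hom) _ = _
      rw [Iso.inv_hom_id, ModuleCat.id_apply]
    conv_rhs => rw [← h1, ← ModuleCat.comp_apply (pushChart y n) (inv (pushChart y n)), IsIso.hom_inv_id,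
      ModuleCat.id_apply]
  rw [localClass_eq_of_isCompatibleAt h]
  change pushIncl y n (inv (pushChart y n) ((signAt o y : ℤ) • g.localClass (chartAt (𝔼 n) y y))) = _
  rw [map_zsmul, ← e3, ← map_zsmul, e1, ModuleCat.comp_apply, map_zsmul, map_zsmul]

end Model

/-! ### The local pieces of a generator of `Hₖ(T)`, `T ≅ Sᵏ` in any universe -/

section Transport

variable {k : ℕ}

/-- **The local pieces of a generator of `Hₖ(T; ℤ)`, `T ≅ Sᵏ`, in Euclidean models of the
preferred charts of `Sᵏ`** (the input `hσ` of
`TransverseDiscDatum.functional_ofAbsolute_map_eq_sum` for an embedded oriented sphere).  Let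
`ψ : Sᵏ ≃ₜ T` (`k ≥ 1`, `T` in any universe), `oS` a smooth orientation of `Sᵏ`, `g` a generator
convention and `σ` a generator of `Hₖ(T; ℤ)`.  Then there is a global sign `t = ±1` such that for
every `y : Sᵏ`, every ball `B = B(φ y, δ)` inside the target of `φ = chartAt y`, every `U ⊆ T` and
every homeomorphism `e : B ≃ U` with `e v = ψ (φ⁻¹ v)`: the class
`(t ε_y) • e⁎ (g_{φ y}|_B)`, pushed from `Hₖ(U | e (φ y))` to `Hₖ(T | e (φ y))`, is the restriction of
`σ` to the point `e (φ y)`; here `ε_y = signAt oS y`.  (Milnor's `[M] ↦ γᵢ`, PDF p. 37, with the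
sign of the preferred chart made explicit.)
[cite: MilnorHCobordism1965, proof of Lemma 6.3 (PDF p. 37), Lemma 7.2 (PDF p. 46); Bredon1993, VI.7 Thm. 7.15; HatcherAT2002, §3.3 Thm. 3.26] -/
theorem exists_units_forall_map_subsetIncl_smul_xEquiv_eq_toLocal (hk : k ≠ 0)
    (g : HomologicalOrientation ℤ (𝔼 k) k) (oS : SmoothOrientation (𝓡 k) (𝕊 k))
    {T : Type u} [TopologicalSpace T] (ψ : (𝕊 k) ≃ₜ T)
    (σ : singularHomology ℤ ℤ T k) (hσ : ∃ e : singularHomology ℤ ℤ T k ≃ₗ[ℤ] ℤ, e σ = 1) :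
    ∃ t : ℤˣ, ∀ (y : 𝕊 k) (δ : ℝ) (hδ : 0 < δ)
      (hB : ball (chartAt (𝔼 k) y y) δ ⊆ (chartAt (𝔼 k) y).target) (U : Set T)
      (e : ↥(ball (chartAt (𝔼 k) y y) δ) ≃ₜ ↥U)
      (_ : ∀ v, (e v : T) = ψ ((chartAt (𝔼 k) y).symm v)),
      relativeSingularHomology.map ℤ ℤ (subsetIncl U)
        (localHomology.mapsTo_subsetIncl_compl (e ⟨chartAt (𝔼 k) y y, mem_ball_self hδ⟩).2) k
        (((t * signAt oS y : ℤˣ) : ℤ) •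
          localHomology.xEquiv ℤ ℤ e ⟨chartAt (𝔼 k) y y, mem_ball_self hδ⟩ k
            ((localHomology.openSubsetIso ℤ ℤ isOpen_ball (mem_ball_self hδ) k).inv
              (g.localClass (chartAt (𝔼 k) y y)))) =
      singularHomology.toLocal ℤ ℤ ((e ⟨chartAt (𝔼 k) y y, mem_ball_self hδ⟩ : ↥U) : T) k σ := by
  -- the compatible orientation `μ` of `Sᵏ` and the pulled-back generator `σ'`
  obtain ⟨μ, hμ, -⟩ := SmoothOrientation.existsUnique_isCompatible_holds (n := k) (M := 𝕊 k) g oS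
  set σ' : singularHomology ℤ ℤ (𝕊 k) k := (singularHomology.xEquiv ℤ ℤ ψ k).symm σ with hσ'
  have hσσ' : singularHomology.xEquiv ℤ ℤ ψ k σ' = σ := LinearEquiv.apply_symm_apply _ _
  have hσ'g : ∃ e : singularHomology ℤ ℤ (𝕊 k) k ≃ₗ[ℤ] ℤ, e σ' = 1 :=
    exists_linearEquiv_apply_eq_one_of_linearEquiv (singularHomology.xEquiv ℤ ℤ ψ k).symm hσ
  obtain ⟨t, ht⟩ := exists_units_forall_toLocal_eq_smul hk μ σ' hσ'g
  refine ⟨t, fun y δ hδ hB U e he => ?_⟩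
  -- reduce to the point `ψ y = e (φ y)`
  have hpt : ψ y = ((e ⟨chartAt (𝔼 k) y y, mem_ball_self hδ⟩ : ↥U) : T) := by
    rw [he, (chartAt (𝔼 k) y).left_inv (mem_chart_source (𝔼 k) y)]
  suffices key : ∀ x : T, ψ y = x →
      ∀ hU : MapsTo (subsetIncl U) ({e ⟨chartAt (𝔼 k) y y, mem_ball_self hδ⟩}ᶜ : Set ↥U) ({x}ᶜ : Set T),
        relativeSingularHomology.map ℤ ℤ (subsetIncl U) hU k
          (((t * signAt oS y : ℤˣ) : ℤ) •
            localHomology.xEquiv ℤ ℤ e ⟨chartAt (𝔼 k) y y, mem_ball_self hδ⟩ k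
              ((localHomology.openSubsetIso ℤ ℤ isOpen_ball (mem_ball_self hδ) k).inv
                (g.localClass (chartAt (𝔼 k) y y)))) =
        singularHomology.toLocal ℤ ℤ x k σ from key _ hpt _
  rintro x rfl hU
  -- `σ|_{ψ y} = ψ⁎ (σ'|_y) = t • ψ⁎ μ_y`
  rw [← hσσ', ← localHomology.xEquiv_toLocal, ht y, map_zsmul,
    localClass_eq_signAt_smul_map_ball g (hμ y) hδ hB, map_zsmul, Units.val_mul, ← smul_smul]
  have key : relativeSingularHomology.map ℤ ℤ (subsetIncl U) hU k
        (localHomology.xEquiv ℤ ℤ e ⟨chartAt (𝔼 k) y y, mem_ball_self hδ⟩ k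
          ((localHomology.openSubsetIso ℤ ℤ isOpen_ball (mem_ball_self hδ) k).inv
            (g.localClass (chartAt (𝔼 k) y y)))) =
      localHomology.xEquiv ℤ ℤ ψ y k
        (relativeSingularHomology.map ℤ ℤ (ballInv y hB) (mapsTo_ballInv y hδ hB) k
          ((localHomology.openSubsetIso ℤ ℤ isOpen_ball (mem_ball_self hδ) k).inv
            (g.localClass (chartAt (𝔼 k) y y)))) :=
    -- transport across universes: the square `subsetIncl U ∘ e = ψ ∘ ballInv`
    (relativeSingularHomology.xEquiv_map ℤ ℤ e ψ (ballInv y hB) (subsetIncl U) (fun v => he v)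
      (mapsTo_compl_singleton e.toEquiv _) (mapsTo_symm_compl_singleton e.toEquiv _)
      (mapsTo_compl_singleton ψ.toEquiv y) (mapsTo_symm_compl_singleton ψ.toEquiv y)
      (mapsTo_ballInv y hδ hB) hU k _).symm
  rw [key, map_zsmul]

end Transport

end SmoothOrientation

end Literature.Topology.FourManifolds

end
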